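import Literature.Geometry.Lorentzian.TameFarFrame
import Literature.Geometry.Lorentzian.LorentzBoost
import HarnessLib

/-!
# Tame far frames with BOOSTED (rest-frame) incoming tail (summit `FinalStateConjecture`)

Companion of `TameFarFrame.lean` (crux `Capture`, item stmt-FinalStateConjecture-10115, line
`far-tail-peeling-one-leaf`): the rest-frame version of the "no incoming radiation" quantity of a
centre, and the predicate `IsTameFarFrameWithBoostedTail` that the planners use to re-type the stubs
`stub_farTail` / `stub_engine` of that line.

## Why (verdict on `stub_farTail`, lead c5, 2026-08-16)

`TameFarFrame.incomingDeriv 𝒟 c U Φ = L(w · h)` differentiates the radius-weighted deviation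
`h = Φ^* g − η` along `outgoingNull c = ∂₀ + ŵ`, the outgoing null vector built from the CHART time
`∂₀`. This is adapted only to a centre at rest in the chart's asymptotic Lorentz frame: for a hole
of mass `M` whose centre moves with chart velocity `v ≠ 0` (centre curve tracking it), its own
boosted Coulomb field `h = F′/R` (`F′ = 2MΛΛᵀ` constant, `R` the rest-frame distance) gives
`w · L(w/R) = γ⁻¹ ‖v‖³ sin²θ cos θ (1 − ‖v‖² sin²θ)^{-3/2}` exactly (`θ` = angle between
`x̲ − c(x⁰)` and `v`), i.e.
`w · |L(w h)₀₀| → 2γ(1 + ‖v‖²)‖v‖³ sin²θ |cos θ| (1 − ‖v‖² sin²θ)^{-3/2} · M ≠ 0`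
(`= 0.156 M` at `‖v‖ = 0.5`, `θ = 45°`; `7.2·10⁻⁴ M` at `‖v‖ = 0.1`), whereas the tail clause of
`IsTameFarFrameWithTail` forces `s · sup_{cellShell} ‖L(wh)‖ ≤ ω(s) + λ(T) + C s²/Dᵢ(T) → 0`.
One tame chart has one asymptotic Lorentz frame, so for `≥ 2` holes with distinct terminal boosts
(allowed by `FinalStateDecomposition.motion`) NO tame far frame with (chart-frame) tail exists, and
`stub_farTail` as typed is mis-stated there. The cure recorded here: weight by the REST-FRAME
distance `Rᵥ` of the centre and differentiate along the BOOSTED outgoing null vector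
`Λᵥ(∂_t̄ + ∂_r̄)` of its velocity `v` — the quantity per-hole capture in hole `i`'s rest frame uses
anyway; for boosted Schwarzschild `Rᵥ · h = F′ + O(M²/Rᵥ)`, so the boosted incoming derivative is
`O(M²/Rᵥ²)`.

## Contents (namespace `Literature.Geometry.Lorentzian`; `γ = Lorentz.gamma v`)

* `restFrameDisp v c x = d + (γ²/(γ+1)) ⟪v, d⟫ v`, `d = x̲ − c(x⁰)` — the rest-frame spatial
  displacement of `x` from the centre (`= d_⊥ + γ d_∥`; `γ²/(γ+1) = (γ − 1)/‖v‖²`, the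
  coefficient of `Lorentz.boostCLM`, so no unit vector `v/‖v‖` and no junk at `v = 0`);
* `restFrameDist v c x = ‖restFrameDisp v c x‖` — the rest-frame distance `Rᵥ`;
* `boostedOutgoingNull v c x = Λᵥ (1, n̄)`, `n̄ = restFrameDisp/restFrameDist`, via
  `Lorentz.boostCLM v` — in components `(γ(1 + ⟪v, n̄⟫), n̄ + (γ²/(γ+1) ⟪v, n̄⟫ + γ) v)`;
* `boostedIncomingDeriv 𝒟 c v U Φ x = D(R_{v(x⁰)} · (Φ^* g − η))(x)[Λ_{v(x⁰)}(1, n̄)(x)]` — the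
  velocity `v : ℝ → E3` of the centre is frozen at the slab time `x⁰` inside the derivative;
* `IsTameFarFrameWithBoostedTail 𝒟 k n c v Rt C T₀ lam om U Φ` — `IsTameFarFrame`, velocities
  uniformly subluminal (`∃ v₀ < 1, ‖vᵢ(t)‖ ≤ v₀`), `ω → 0`, and the boosted tail clause
  `sup_{cellShell i} ‖boostedIncomingDeriv (c i) (v i)‖_{Cᵏ} ≤ (ω(s) + λ(T))/s + C s/Dᵢ(T)`;
* the `v = 0` reductions `restFrameDisp_zero`, `restFrameDist_zero`, `boostedOutgoingNull_zero`,
  `boostedIncomingDeriv_zero`, `isTameFarFrameWithBoostedTail_zero_iff` (at rest the new notions ARE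
  the old ones, so `stub_minkowskiTameFarFrame`-type anti-vacuity transfers), the projections, and
  `IsTameFarFrameWithBoostedTail.of_le` (monotonicity in the order `k`).

## Sources and status

Lorentz boost conventions: Jackson (11.19) / O'Neill 1983, Ch. 9, as in `LorentzBoost.lean`. The
lowest-order pointwise peeling the tail clause encodes: Christodoulou–Klainerman 1993, Ch. 17,
Conclusion 17.0.1; Klainerman–Nicolò, CQG 20 (2003). The predicate itself is route-posited (as
`IsTameFarFrameWithTail`); nothing is asserted about it — definitions and `v = 0` bookkeeping only.
-/

noncomputable section

open Set Filter Function Topology TopologicalSpace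
open scoped Manifold ContDiff ENNReal

universe u

namespace Literature.Geometry.Lorentzian

/-! ### Rest-frame geometry of a moving centre -/

section BoostedGeometry

/-- The Lorentz factor of the zero velocity is `1`. [folklore] -/
@[simp]
theorem Lorentz.gamma_zero : Lorentz.gamma (0 : E3) = 1 := by
  simp [Lorentz.gamma]

/-- The boost with zero velocity is the identity. [cite: ONeill1983, Ch. 9, pp. 233–236] -/
@[simp]
theorem Lorentz.boostCLM_zero_apply (x : E4) : Lorentz.boostCLM (0 : E3) x = x := by
  have h0 : Lorentz.boostCLM (0 : E3) x 0 = x 0 := by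
    rw [Lorentz.boostCLM_apply_zero]; simp
  have hs : E4.spatial (Lorentz.boostCLM (0 : E3) x) = E4.spatial x := by
    rw [Lorentz.spatial_boostCLM_apply]; simp
  calc Lorentz.boostCLM (0 : E3) x
      = E4.ofTimeSpace (E4.time (Lorentz.boostCLM (0 : E3) x))
          (E4.spatial (Lorentz.boostCLM (0 : E3) x)) := (E4.ofTimeSpace_time_spatial _).symm
    _ = E4.ofTimeSpace (E4.time x) (E4.spatial x) := by rw [E4.time_apply, E4.time_apply, h0, hs]
    _ = x := E4.ofTimeSpace_time_spatial x

/-- REST-FRAME DISPLACEMENT of `x` from the centre `c` moving with velocity `v`: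
`d + (γ²/(γ+1)) ⟪v, d⟫ v` with `d = x̲ − c(x⁰)`, i.e. `d_⊥ + γ d_∥` — the spatial part of the
inverse boost of the chart-simultaneous displacement `(0, d)` (for a uniformly moving centre, the
position of `x` relative to the centre in the centre's rest frame). `γ²/(γ+1) = (γ−1)/‖v‖²` is the
coefficient of `Lorentz.boostCLM` (Jackson (11.19)). [cite: ONeill1983, Ch. 9, pp. 233–236] -/
def restFrameDisp (v : E3) (c : ℝ → E3) (x : E4) : E3 :=
  (E4.spatial x - c (x 0)) +
    (Lorentz.gamma v ^ 2 / (Lorentz.gamma v + 1) * inner ℝ v (E4.spatial x - c (x 0))) • v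

/-- Unfolding lemma for `restFrameDisp`. [cite: ONeill1983, Ch. 9, pp. 233–236] -/
theorem restFrameDisp_def (v : E3) (c : ℝ → E3) (x : E4) :
    restFrameDisp v c x = (E4.spatial x - c (x 0)) +
      (Lorentz.gamma v ^ 2 / (Lorentz.gamma v + 1) * inner ℝ v (E4.spatial x - c (x 0))) • v :=
  rfl

/-- At rest the rest-frame displacement is the chart displacement `x̲ − c(x⁰)`. [folklore] -/
@[simp]
theorem restFrameDisp_zero (c : ℝ → E3) (x : E4) :
    restFrameDisp 0 c x = E4.spatial x - c (x 0) := by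
  simp [restFrameDisp]

/-- REST-FRAME DISTANCE `Rᵥ(x) = ‖restFrameDisp v c x‖ = (|d_⊥|² + γ²|d_∥|²)^{1/2}` of `x` from the
moving centre. [cite: ONeill1983, Ch. 9, pp. 233–236] -/
def restFrameDist (v : E3) (c : ℝ → E3) (x : E4) : ℝ := ‖restFrameDisp v c x‖

/-- Unfolding lemma for `restFrameDist`. [cite: ONeill1983, Ch. 9, pp. 233–236] -/
theorem restFrameDist_def (v : E3) (c : ℝ → E3) (x : E4) :
    restFrameDist v c x = ‖restFrameDisp v c x‖ := rfl

/-- The rest-frame distance is nonnegative. [folklore] -/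
theorem restFrameDist_nonneg (v : E3) (c : ℝ → E3) (x : E4) : 0 ≤ restFrameDist v c x :=
  norm_nonneg _

/-- At rest the rest-frame distance is the chart distance `centreDist`. [folklore] -/
@[simp]
theorem restFrameDist_zero (c : ℝ → E3) (x : E4) : restFrameDist 0 c x = centreDist c x := by
  rw [restFrameDist, restFrameDisp_zero, centreDist_def]

/-- At rest, `restFrameDist 0 c = centreDist c` as functions. [folklore] -/
theorem restFrameDist_zero_eq (c : ℝ → E3) : restFrameDist 0 c = centreDist c :=
  funext (restFrameDist_zero c)

/-- The BOOSTED OUTGOING NULL VECTOR of the centre `c` with velocity `v` at `x`: the rest-frame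
outgoing null vector `∂_t̄ + ∂_r̄ = (1, n̄)`, `n̄ = restFrameDisp/restFrameDist`, pushed to chart
components by the boost `Λᵥ = Lorentz.boostCLM v`:
`(γ(1 + ⟪v, n̄⟫), n̄ + (γ²/(γ+1) ⟪v, n̄⟫ + γ) v)`. Null for `η` off the centre
(`Lorentz.minkowski_boostCLM`). Christodoulou–Klainerman 1993, Ch. 17 (`l = T + N`), in the
rest frame of the centre. [cite: ChristodoulouKlainerman1993PMS41, Ch. 17, Conclusion 17.0.1] -/
def boostedOutgoingNull (v : E3) (c : ℝ → E3) (x : E4) : E4 :=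
  Lorentz.boostCLM v (E4.ofTimeSpace 1 ((restFrameDist v c x)⁻¹ • restFrameDisp v c x))

/-- Unfolding lemma for `boostedOutgoingNull`.
[cite: ChristodoulouKlainerman1993PMS41, Ch. 17, Conclusion 17.0.1] -/
theorem boostedOutgoingNull_def (v : E3) (c : ℝ → E3) (x : E4) :
    boostedOutgoingNull v c x =
      Lorentz.boostCLM v (E4.ofTimeSpace 1 ((restFrameDist v c x)⁻¹ • restFrameDisp v c x)) :=
  rfl

/-- Time component of the boosted outgoing null vector: `γ (1 + ⟪v, n̄⟫)`.
[cite: ONeill1983, Ch. 9, pp. 233–236] -/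
theorem boostedOutgoingNull_apply_zero (v : E3) (c : ℝ → E3) (x : E4) :
    boostedOutgoingNull v c x 0 =
      Lorentz.gamma v * (1 + inner ℝ v ((restFrameDist v c x)⁻¹ • restFrameDisp v c x)) := by
  rw [boostedOutgoingNull, Lorentz.boostCLM_apply_zero, E4.ofTimeSpace_apply_zero,
    E4.spatial_ofTimeSpace]

/-- Spatial part of the boosted outgoing null vector: `n̄ + (γ²/(γ+1) ⟪v, n̄⟫ + γ) v`.
[cite: ONeill1983, Ch. 9, pp. 233–236] -/
theorem spatial_boostedOutgoingNull (v : E3) (c : ℝ → E3) (x : E4) :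
    E4.spatial (boostedOutgoingNull v c x) =
      (restFrameDist v c x)⁻¹ • restFrameDisp v c x +
        (Lorentz.gamma v ^ 2 / (Lorentz.gamma v + 1) *
            inner ℝ v ((restFrameDist v c x)⁻¹ • restFrameDisp v c x) +
          Lorentz.gamma v * 1) • v := by
  rw [boostedOutgoingNull, Lorentz.spatial_boostCLM_apply, E4.ofTimeSpace_apply_zero,
    E4.spatial_ofTimeSpace]

/-- The boosted outgoing null vector is `η`-null off the centre (`‖n̄‖ = 1` and the boost preserves
`η`). [cite: ONeill1983, Ch. 9, p. 234] -/
theorem minkowski_bilin_boostedOutgoingNull {v : E3} (hv : ‖v‖ < 1) (c : ℝ → E3) {x : E4}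
    (h : restFrameDist v c x ≠ 0) :
    Minkowski.bilin (boostedOutgoingNull v c x) (boostedOutgoingNull v c x) = 0 := by
  rw [boostedOutgoingNull, Lorentz.minkowski_boostCLM hv, Lorentz.minkowski_bilin_eq_inner,
    E4.ofTimeSpace_apply_zero, E4.spatial_ofTimeSpace, real_inner_self_eq_norm_sq, norm_smul,
    norm_inv, Real.norm_of_nonneg (restFrameDist_nonneg v c x), ← restFrameDist_def,
    inv_mul_cancel₀ h]
  ring

/-- At rest the boosted outgoing null vector is `outgoingNull c = ∂₀ + ŵ`. [folklore] -/
@[simp]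
theorem boostedOutgoingNull_zero (c : ℝ → E3) (x : E4) :
    boostedOutgoingNull 0 c x = outgoingNull c x := by
  rw [boostedOutgoingNull, Lorentz.boostCLM_zero_apply, restFrameDist_zero, restFrameDisp_zero]
  rfl

/-- At rest, `boostedOutgoingNull 0 c = outgoingNull c` as vector fields. [folklore] -/
theorem boostedOutgoingNull_zero_eq (c : ℝ → E3) : boostedOutgoingNull 0 c = outgoingNull c :=
  funext (boostedOutgoingNull_zero c)

end BoostedGeometry

/-! ### The boosted incoming derivative and tame far frames with boosted tail -/

section BoostedFarFrame

variable {X : Type u} [TopologicalSpace X] [ChartedSpace E3 X] [IsManifold (𝓡 3) ∞ X]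
  [ConnectedSpace X] {D : InitialDataSet (𝓡 3) X}

/-- The BOOSTED INCOMING DERIVATIVE field of the centre `c` with velocity `v : ℝ → E3`:
`x ↦ D(R_{v(x⁰)} · (Φ^* g − η))(x)[Λ_{v(x⁰)}(1, n̄)(x)]`, the derivative of the
rest-frame-radius-weighted deviation along the boosted outgoing null vector, the velocity frozen at
the slab time `x⁰` (no `v̇` terms). This is the "no incoming radiation" quantity of hole `c` IN ITS
OWN REST FRAME: it annihilates the hole's boosted Coulomb field `2MΛΛᵀ/Rᵥ` to leading order,
which the chart-frame `incomingDeriv` does not when `v ≠ 0` (module docstring: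
`w·|L(wh)₀₀| → 0.156 M` at `‖v‖ = 0.5`, `θ = 45°`).
Lowest-order peeling along outgoing cones: Christodoulou–Klainerman 1993, Ch. 17, Conclusion 17.0.1.
[cite: ChristodoulouKlainerman1993PMS41, Ch. 17, Conclusion 17.0.1] -/
def boostedIncomingDeriv (𝒟 : CauchyDevelopment D) (c : ℝ → E3) (v : ℝ → E3) (U : Opens E4)
    (Φ : U → 𝒟.carrier) : E4 → E4 →L[ℝ] E4 →L[ℝ] ℝ :=
  fun x ↦ fderiv ℝ (fun y ↦ restFrameDist (v (x 0)) c y • farDeviation 𝒟 U Φ y) x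
    (boostedOutgoingNull (v (x 0)) c x)

/-- Unfolding lemma for `boostedIncomingDeriv`.
[cite: ChristodoulouKlainerman1993PMS41, Ch. 17, Conclusion 17.0.1] -/
theorem boostedIncomingDeriv_apply (𝒟 : CauchyDevelopment D) (c : ℝ → E3) (v : ℝ → E3)
    (U : Opens E4) (Φ : U → 𝒟.carrier) (x : E4) :
    boostedIncomingDeriv 𝒟 c v U Φ x =
      fderiv ℝ (fun y ↦ restFrameDist (v (x 0)) c y • farDeviation 𝒟 U Φ y) x
        (boostedOutgoingNull (v (x 0)) c x) :=
  rfl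

/-- At rest (`v ≡ 0`) the boosted incoming derivative IS the chart-frame `incomingDeriv`.
[folklore] -/
@[simp]
theorem boostedIncomingDeriv_zero (𝒟 : CauchyDevelopment D) (c : ℝ → E3) (U : Opens E4)
    (Φ : U → 𝒟.carrier) : boostedIncomingDeriv 𝒟 c (fun _ ↦ 0) U Φ = incomingDeriv 𝒟 c U Φ := by
  funext x
  rw [boostedIncomingDeriv_apply, incomingDeriv_apply, restFrameDist_zero_eq,
    boostedOutgoingNull_zero]

/-- **TAME FAR FRAME WITH BOOSTED TAIL** (order `k`, modulus `ω → 0`, centre velocities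
`v : Fin n → ℝ → E3`): a tame far frame whose centre velocities are uniformly subluminal
(`∃ v₀ < 1, ‖vᵢ(t)‖ ≤ v₀`, so `γ` stays bounded) and in which the BOOSTED incoming derivative of
every centre `i`, in `Cᵏ` sup over the dyadic shell of `i`'s Voronoi cell at distance `∼ s` on the
slab `{x⁰ = T}`, is `≤ (ω(s) + λ(T))/s + C s / Dᵢ(T)` — the datum's `o₂` tail transported
(rate-free), early junk, and the companions' fields seen at relative size `s/Dᵢ`. Correction of
`IsTameFarFrameWithTail` for moving centres (that predicate charges a hole moving at chart speed `v`
its own Coulomb field, `s · sup ≥ c(v) M ↛ 0`, hence is empty for `≥ 2` holes with distinct terminal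
boosts); a badly chosen `v` only hurts the prover, and `v ≡ 0` gives back `IsTameFarFrameWithTail`
(`isTameFarFrameWithBoostedTail_zero_iff`). Route-posited hypothesis shape; the peeling it encodes
at lowest order: Christodoulou–Klainerman 1993, Ch. 17, Conclusion 17.0.1.
[cite: ChristodoulouKlainerman1993PMS41, Ch. 17, Conclusion 17.0.1] -/
def IsTameFarFrameWithBoostedTail (𝒟 : CauchyDevelopment D) (k n : ℕ) (c : Fin n → ℝ → E3)
    (v : Fin n → ℝ → E3) (Rt C T₀ : ℝ) (lam om : ℝ → ℝ) (U : Opens E4) (Φ : U → 𝒟.carrier) :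
    Prop :=
  IsTameFarFrame 𝒟 k n c Rt C T₀ lam U Φ ∧ (∃ v₀ : ℝ, v₀ < 1 ∧ ∀ i t, ‖v i t‖ ≤ v₀) ∧
  Tendsto om atTop (𝓝 0) ∧
  ∀ (i : Fin n) (T s : ℝ), T₀ < T → 0 < s →
    supCkENorm (cellShell c i Rt T s) k (boostedIncomingDeriv 𝒟 (c i) (v i) U Φ) ≤
      ENNReal.ofReal ((om s + lam T) / s + C * s / separation c i T)

namespace IsTameFarFrameWithBoostedTail

variable {𝒟 : CauchyDevelopment D} {k k' n : ℕ} {c : Fin n → ℝ → E3} {v : Fin n → ℝ → E3}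
  {Rt C T₀ : ℝ} {lam om : ℝ → ℝ} {U : Opens E4} {Φ : U → 𝒟.carrier}

/-- A tame far frame with boosted tail is in particular a tame far frame. [folklore] -/
theorem isTameFarFrame (h : IsTameFarFrameWithBoostedTail 𝒟 k n c v Rt C T₀ lam om U Φ) :
    IsTameFarFrame 𝒟 k n c Rt C T₀ lam U Φ :=
  h.1

/-- The centre velocities of a tame far frame with boosted tail are uniformly subluminal.
[folklore] -/
theorem exists_norm_velocity_le (h : IsTameFarFrameWithBoostedTail 𝒟 k n c v Rt C T₀ lam om U Φ) :
    ∃ v₀ : ℝ, v₀ < 1 ∧ ∀ i t, ‖v i t‖ ≤ v₀ :=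
  h.2.1

/-- Each centre velocity is subluminal, `‖vᵢ(t)‖ < 1`. [folklore] -/
theorem norm_velocity_lt_one (h : IsTameFarFrameWithBoostedTail 𝒟 k n c v Rt C T₀ lam om U Φ)
    (i : Fin n) (t : ℝ) : ‖v i t‖ < 1 := by
  obtain ⟨v₀, hv₀, hv⟩ := h.exists_norm_velocity_le
  exact (hv i t).trans_lt hv₀

/-- The tail modulus tends to `0`. [folklore] -/
theorem tendsto_modulus (h : IsTameFarFrameWithBoostedTail 𝒟 k n c v Rt C T₀ lam om U Φ) :
    Tendsto om atTop (𝓝 0) :=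
  h.2.2.1

/-- The BOOSTED INCOMING-TAIL bound:
`‖Λ_{vᵢ}(1,n̄)(R_{vᵢ} · h)‖_{Cᵏ(cellShell i)} ≤ (ω(s) + λ(T))/s + C s / Dᵢ(T)`.
[cite: ChristodoulouKlainerman1993PMS41, Ch. 17, Conclusion 17.0.1] -/
theorem supCkENorm_boostedIncomingDeriv_le
    (h : IsTameFarFrameWithBoostedTail 𝒟 k n c v Rt C T₀ lam om U Φ) (i : Fin n) {T s : ℝ}
    (hT : T₀ < T) (hs : 0 < s) :
    supCkENorm (cellShell c i Rt T s) k (boostedIncomingDeriv 𝒟 (c i) (v i) U Φ) ≤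
      ENNReal.ofReal ((om s + lam T) / s + C * s / separation c i T) :=
  h.2.2.2 i T s hT hs

/-- Tame far frames with boosted tail lose nothing when the order is lowered. [folklore] -/
theorem of_le (h : IsTameFarFrameWithBoostedTail 𝒟 k' n c v Rt C T₀ lam om U Φ) (hk : k ≤ k') :
    IsTameFarFrameWithBoostedTail 𝒟 k n c v Rt C T₀ lam om U Φ :=
  ⟨h.1.of_le hk, h.2.1, h.2.2.1,
    fun i T s hT hs ↦ (supCkENorm_mono_right _ hk _).trans (h.2.2.2 i T s hT hs)⟩

end IsTameFarFrameWithBoostedTail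

/-- **At rest the boosted predicate IS the chart-frame one**: with all velocities `0` the subluminal
clause holds with `v₀ = 0` and `boostedIncomingDeriv … (fun _ ↦ 0) = incomingDeriv …`. In particular
every witness of `IsTameFarFrameWithTail` (e.g. Minkowski's resting virtual centre) is one of
`IsTameFarFrameWithBoostedTail`. [folklore] -/
theorem isTameFarFrameWithBoostedTail_zero_iff (𝒟 : CauchyDevelopment D) (k n : ℕ)
    (c : Fin n → ℝ → E3) (Rt C T₀ : ℝ) (lam om : ℝ → ℝ) (U : Opens E4) (Φ : U → 𝒟.carrier) :
    IsTameFarFrameWithBoostedTail 𝒟 k n c (fun _ _ ↦ 0) Rt C T₀ lam om U Φ ↔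
      IsTameFarFrameWithTail 𝒟 k n c Rt C T₀ lam om U Φ := by
  constructor
  · rintro ⟨h1, -, h3, h4⟩
    refine ⟨h1, h3, fun i T s hT hs ↦ ?_⟩
    have := h4 i T s hT hs
    rwa [boostedIncomingDeriv_zero] at this
  · rintro ⟨h1, h2, h3⟩
    refine ⟨h1, ⟨0, one_pos, fun i t ↦ by simp⟩, h2, fun i T s hT hs ↦ ?_⟩
    rw [boostedIncomingDeriv_zero]
    exact h3 i T s hT hs

/-- From a tame far frame with (chart-frame) tail to one with boosted tail and zero velocities.
[folklore] -/
theorem IsTameFarFrameWithTail.withBoostedTail_zero {𝒟 : CauchyDevelopment D} {k n : ℕ}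
    {c : Fin n → ℝ → E3} {Rt C T₀ : ℝ} {lam om : ℝ → ℝ} {U : Opens E4} {Φ : U → 𝒟.carrier}
    (h : IsTameFarFrameWithTail 𝒟 k n c Rt C T₀ lam om U Φ) :
    IsTameFarFrameWithBoostedTail 𝒟 k n c (fun _ _ ↦ 0) Rt C T₀ lam om U Φ :=
  (isTameFarFrameWithBoostedTail_zero_iff 𝒟 k n c Rt C T₀ lam om U Φ).2 h

end BoostedFarFrame

end Literature.Geometry.Lorentzian

end
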